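import Summits.QuantumFields.YangMills.Theorems.UnitScaleTiltProp7HDOfCombRowsT3
import Summits.QuantumFields.YangMills.Theorems.UnitScaleTiltProp7CombPeriodCellDict
import Summits.QuantumFields.YangMills.Theorems.UnitScaleTiltProp7CombTowerWindowsOfRegPrT3
import Summits.QuantumFields.YangMills.Theorems.UnitScaleTiltProp7CombTowerPertWindowsOfIn19T3
import Summits.QuantumFields.YangMills.Theorems.UnitScaleTiltProp7CombCellLevelZeroCurrencyT3
import Summits.QuantumFields.YangMills.Theorems.UnitScaleTiltProp7CornerCombFamiliesPeriodic
import Summits.QuantumFields.YangMills.Theorems.UnitScaleTiltProp7CornerCombCellTheoremMember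
import Summits.QuantumFields.YangMills.Theorems.UnitScaleTiltProp7CombLevelMassSlotLetters
import Summits.QuantumFields.YangMills.Theorems.UnitScaleTiltProp7CombLevelMassMemberT3Letters
import Summits.QuantumFields.YangMills.Theorems.UnitScaleTiltProp7CombTildRem2HMcomb2MemberRowsT3
import Summits.QuantumFields.YangMills.Theorems.UnitScaleTiltProp7CornerCombGaugeRowWeights
import Summits.QuantumFields.YangMills.Theorems.UnitScaleTiltProp7CombHMcombFrozenLetters
import Summits.QuantumFields.YangMills.Theorems.UnitScaleTiltProp7CornerCombGaugeRowInhabited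
import HarnessLib

/-!
# Route `UnitScaleTilt`, crux K1 «MinimiserStabilityRegPr» (stmt-QuantumFields-19200), route-R E′ (A′)-on-Σ, P-A2 (β), row «(n3)-comb» —
# (O2) GROUNDWORK, file F-8c-final-2 «`hMcomb_holds`»: THE (II) LANE «COMB = STRAIGHT ∘ BLOCK-AXIAL» CLOSES G3's DISPLAYED ROW `hMc` AT THE MEMBER

«(O2) groundwork — route-internal row (n3)-comb, NOT N06, NOT a print row» (★★OWNER `ym3-torus-plan` RULINGS №19 O4, №20 (1)(2), №22 (c) «(II) GO»).
Cell `ym3-torus`, D-0154 (3c) R3 twin-width seat `ym-routeR-w1` (gen 10, (II) pen-namer; pens of record 2026-08-29 12:17Z SWAP: knit routeR-w1, gauge row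
★routeR-w6 g9).  THEOREMS ONLY (0 `def`, 0 `sorry`); `--supports stmt-QuantumFields-19200 --as helper`, count-neutral.  YM₃ on T³ is a ladder rung (R3), not the Clay
problem; nothing here claims `hMcomb₂`, (β), `hPA2`, the stub `stub_existenceMinimalOrbit`, the crux, d = 4 or the mass gap.

THE THEOREM.  ★★★ `hMcomb_holds` has EXACTLY the type of the hypothesis `hMc` of ✓`Prop7HDOfCombRows.hD_of_hMcomb` (G3): for every block size `L > 1` and `B₁′ > 0` there
are `eC A B B′` (closed in `(L, B₁′)`, chosen BEFORE `F n K e W X`) such that for `W ∈ regFibrePr … e …` (`e ≤ eC`) and `X` in (19)'s window `In19 … (2B₁′e) …`, at every level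
`l < K − n`, `Σ_{z,κ} ‖Ũˡ(z,κ) − 1‖² ≤ A·M·(Lˡ)⁻¹ + (B·(CURL + DIV) + B′·ℓ⁻²·M)·Lˡ` for the comb tower `Ũ = tildIter L U₀♯ U₁♯` of the based pullbacks, `M = Σ_b‖X b‖²`,
`ℓ = L^{K−n}`.  PROOF = ASSEMBLY BY NAME (no new estimate): the frozen letters at `eC` (✓`…CombHMcombFrozenLetters.frozen_letters` over ✓`…MemberT3Letters.windows_at_eC`),
the cell weights by equality (✓`…GaugeRowWeights`, ★routeR-w4 g18), `RegPr` at `(12B₁′+1)e` (lit ✓`regPr_mono`), the tower windows ✓F-8c-3a∕✓F-8c-3b, the period dictionary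
✓F-8a + ✓`sitesPerDir_eq_mul_pow_sub`, the three families ✓F-8b-1, the geometric rows ✓`…SlotLetters` §5, THE CELL THEOREM ✓F-8b-4 v2 `sum_cell_normSq_tild_le_two_slot` with
its gauge row `hrow` supplied by ★routeR-w6 g9's ✓`…GaugeRowInhabited.gauge_row_inhabited` (over ✓F-6d-3′ and ✓F-8b-5a), then ✓`A_letter_eq`∕`B_letter_eq`, ✓`rho_slots_T3`,
the level-0 currencies ✓F-8c-2 and ★✓`two_slot_to_hMc_slots`.  One decl-local `maxHeartbeats 400000` (the 68-binder application plus four written-out kernel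
coefficient texts; README HEARTBEAT rule).
HONEST SCOPE.  `hMc` is ONE of the three labelled route-internal rows of S34ᴸ; landing this file does not consume it (EX-namer ∕ ★★OWNER step); `hMcomb₂`, (β), EX, the crux stay OPEN.

References: T. Bałaban [Balaban1985Variational] CMP 102 ((2), (14), (19)–(20), (106)–(111)); [Balaban1985Averaging] CMP 98 ((42)–(54), (68)–(69), Prop. 3 (122)–(126)); [Balaban1987RG1] CMP 109 ((0.1), (0.4)).
-/

set_option autoImplicit false

noncomputable section

open scoped BigOperators Matrix.Norms.L2Operator
open NormedSpace

namespace Summit.QuantumFields.YangMills.Theorems.Prop7CombHMcombHolds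

open Literature.MathematicalPhysics.QuantumFieldTheory.Balaban1983to89
open Literature.MathematicalPhysics.QuantumFieldTheory.Balaban1983to89.T3ContinuumYM3Torus
open Literature.MathematicalPhysics.QuantumFieldTheory.Balaban1983to89.T3UnitLawDensityEML (ℰp)
open Literature.MathematicalPhysics.QuantumFieldTheory.Balaban1983to89.T3ConstrainedMinimiser (fibre)
open Literature.MathematicalPhysics.QuantumFieldTheory.Balaban1983to89.T3PrintedRegularMinimiser
open T4Continuum ExpMeanLog
open B7Prop1Explicit renaming Site → LSite
open B7Prop1Explicit (e hol seg boxVec gammaWord Wcx Xavg expUnit U1)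
open B7Prop2Explicit (avgIter unitaryUnits unitaryUnits_le_U1)
open B7Eq92Concrete (tildIter tildIter_zero')
open B7Eq78Linearization (conjR)
open B7Prop3GeneralRotated (tsum)
open B7Prop3GeneralLinear (FhatCov)
open T4TermwiseTorus (IsPeriodic tlift)
open B10Eq27TorusAxialLog (pull unitsField toUField)
open B9Eq39Adjoint (divB)
open B9TorusCalculus (torusT)
open T3SectALandauChart (eta eta_pos bgUnits In19)
open Summit.QuantumFields.YangMills.Theorems.Prop7SPrint (basePt AvgCondPrint IsLandauPrint)
open Summit.QuantumFields.YangMills.Theorems.Prop7TPrint (expHermField)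
open Summit.QuantumFields.YangMills.Theorems.Prop7CombPeriodCellDict (sum_site_eq_sum_boxVec sitesPerDir_T3 sitesPerDir_T3_mul_pow)
open Summit.QuantumFields.YangMills.Theorems.Prop7LandauCombDict (isPeriodic_pull)
open Summit.QuantumFields.YangMills.Theorems.Prop7CombTowerWindowsOfRegPr (norm_hol_plaqWord_avgIter_pull_sub_one_le_of_regPr
  norm_Wcx_avgIter_pull_sub_one_le_level_of_regPr alpha_level_le_window avgIter_pull_mem_unitaryUnits_of_regPr)
open Summit.QuantumFields.YangMills.Theorems.Prop7CombTowerPertWindowsOfIn19 (comb_tower_pert_rows_of_regPr_of_in19 mu_level_eq_inv_pow)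
open Summit.QuantumFields.YangMills.Theorems.Prop7CombCellLevelZeroCurrencyT3 (cellGrad_tildIter_zero_le_of_regPr_of_in19_T3 cellMass_Y0_le_of_in19_T3)
open Summit.QuantumFields.YangMills.Theorems.Prop7CornerCombFamiliesPeriodic (exists_sourced_reduced_family exists_gauge_family)
open Summit.QuantumFields.YangMills.Theorems.Prop7CornerCombCellTheorem (rho_slots_T3 rho_letters_T3)
open Summit.QuantumFields.YangMills.Theorems.Prop7CornerCombCellTheoremMember (sum_cell_normSq_tild_le_two_slot)
open Summit.QuantumFields.YangMills.Theorems.Prop7CombLevelMassSlotLetters (rho_pow_four_mul hcAsq_of_choice hcB0sq_of_choice hcB1sq_of_choice sqrt_mul_nonneg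
  A_letter_eq B_letter_eq two_slot_to_hMc_slots hMc_constants_nonneg grad_currency_mono a_level_le_frozen mu_level_le_frozen kappa_geo_of_windows K_geo_of_windows
  sigma_geo_of_windows)
open Summit.QuantumFields.YangMills.Theorems.Prop7CombHMcombFrozenLetters (frozen_letters)
open Summit.QuantumFields.YangMills.Theorems.Prop7CornerCombGaugeRowInhabited (gauge_row_inhabited)
open Summit.QuantumFields.YangMills.Theorems.Prop7CornerCombGaugeRowWeights (wG_choice_nonneg wN_choice_nonneg wS_choice_nonneg wM_choice_nonneg
  ThetaM_choice_nonneg wM_choice_geo numerals_nC_AC)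
open Literature.MathematicalPhysics.QuantumFieldTheory.Balaban1983to89.T3PrintedMinimiserExistence (regPr_mono)
open Summit.QuantumFields.YangMills.Theorems.Prop7CombTildRem2HMcomb2MemberRowsT3 (sitesPerDir_eq_mul_pow_sub)

/-! ## ★★★ `hMcomb_holds` -/

set_option maxHeartbeats 400000 in
/-- ★★★ **`hMcomb_holds` — THE ROW `hMc` OF G3 ✓`Prop7HDOfCombRows.hD_of_hMcomb`, TYPE VERBATIM** (see the module docstring for the assembly; every analytic input is a landed
theorem of the (II) lane consumed by name). [cite: Balaban1985Variational, (2) p.278, (19)–(20) p.281, (106)–(111) p.294; Balaban1985Averaging, Prop. 3 (122)–(126) p.36;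
Balaban1987RG1, (0.1), (0.4) pp.251–253] -/
theorem hMcomb_holds :
    ∀ (L : ℕ), 1 < L → ∀ (B₁' : ℝ), 0 < B₁' → ∃ eC A B B' : ℝ, 0 < eC ∧ 0 ≤ A ∧ 0 ≤ B ∧ 0 ≤ B' ∧
      ∀ (F : T3Family), F.L = L → ∀ (n K : ℕ) (hnK : n < K) (e : ℝ) (V : GaugeField (F.P n) 0 (Matrix.specialUnitaryGroup (Fin 2) ℂ))
        (W : GaugeField (F.P K) 0 (Matrix.specialUnitaryGroup (Fin 2) ℂ)) (X : PBond (F.P K) 0 → Matrix (Fin 2) (Fin 2) ℂ),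
        0 < e → e ≤ eC → W ∈ regFibrePr F n K hnK.le e V →
        (∀ γ : ℝ → GaugeField (F.P K) 0 (Matrix.specialUnitaryGroup (Fin 2) ℂ), γ 0 = W → (∀ t, γ t ∈ fibre F ℰp n K hnK.le V) →
          (∀ b, DifferentiableAt ℝ (fun t => ((γ t b : Matrix.specialUnitaryGroup (Fin 2) ℂ) : Matrix (Fin 2) (Fin 2) ℂ)) 0) →
            deriv (fun t => wilsonAction4 (γ t)) 0 = 0) →
        In19 F n K (2 * B₁' * e) W (expHermField X) X → AvgCondPrint F n K hnK.le V W X → IsLandauPrint F n K W X →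
          ∀ l : ℕ, l < K - n →
            ∑ z : Site (F.P K) l, ∑ κ : Fin (F.P K).d,
              ‖((tildIter (F.P K).L (pull (bgUnits F K W) (basePt F n K)) (pull (fun b => expUnit (Complex.I • X b)) (basePt F n K)) l
              (fun μ => ((z μ).val : ℤ)) κ : (Matrix (Fin 2) (Fin 2) ℂ)ˣ) : Matrix (Fin 2) (Fin 2) ℂ) - 1‖ ^ 2
              ≤ A * (∑ b : PBond (F.P K) 0, ‖X b‖ ^ 2) * ((F.L : ℝ) ^ l)⁻¹
                + (B * ((∑ p : Plaq (F.P K) 0, ‖((Complex.I • X ⟨p.src, p.μ⟩) + ((W ⟨p.src, p.μ⟩ : Matrix (Fin 2) (Fin 2) ℂ) * (Complex.I • X ⟨p.src.shift p.μ, p.ν⟩) * star (W ⟨p.src, p.μ⟩ : Matrix (Fin 2) (Fin 2) ℂ))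
            - (((W ⟨p.src, p.μ⟩ * W ⟨p.src.shift p.μ, p.ν⟩ * (W ⟨p.src.shift p.ν, p.μ⟩)⁻¹ : Matrix.specialUnitaryGroup (Fin 2) ℂ) : Matrix (Fin 2) (Fin 2) ℂ) * (Complex.I • X ⟨p.src.shift p.ν, p.μ⟩) * star ((W ⟨p.src, p.μ⟩ * W ⟨p.src.shift p.μ, p.ν⟩ * (W ⟨p.src.shift p.ν, p.μ⟩)⁻¹ : Matrix.specialUnitaryGroup (Fin 2) ℂ) : Matrix (Fin 2) (Fin 2) ℂ))
            - (((GaugeField.plaqHol W p : Matrix.specialUnitaryGroup (Fin 2) ℂ) : Matrix (Fin 2) (Fin 2) ℂ) * (Complex.I • X ⟨p.src, p.ν⟩) * star ((GaugeField.plaqHol W p : Matrix.specialUnitaryGroup (Fin 2) ℂ) : Matrix (Fin 2) (Fin 2) ℂ)))‖ ^ 2) + (∑ x : Site (F.P K) 0, ∑ j : Fin 2, ∑ k : Fin 2,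
              ‖(divB (torusT (F.P K) 0) (fun κ z => unitsField (toUField W) ⟨z, κ⟩) (fun κ z => Complex.I • X ⟨z, κ⟩) x) j k‖ ^ 2))
                  + B' * (((F.L : ℝ) ^ (K - n)) ^ 2)⁻¹ * (∑ b : PBond (F.P K) 0, ‖X b‖ ^ 2)) * (F.L : ℝ) ^ l := by
  intro L hL B₁' hB₁'
  have hL1r : (1 : ℝ) < (L : ℝ) := by exact_mod_cast hL
  have hL0r : (0 : ℝ) < (L : ℝ) := by linarith
  -- F-8b-5b's cell weights BY EQUALITY (5b-1's domination rows at `d = 3`, `N = 2`, `nC := L·L+L−1`, `AC := 2`; routeR-w4 g18's letters)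
  obtain ⟨wG, hwGdef⟩ : ∃ w : ℝ, w = 2 * (3 * ((Real.sqrt L)⁻¹ * (((3 : ℕ) : ℝ) * ((L : ℝ) ^ 2 / 4) * (2 * ((L : ℝ) ^ (3 : ℕ))⁻¹ * (L : ℝ) * (L : ℝ)))
      + (L : ℝ)⁻¹ * (2 * ((3 : ℕ) : ℝ) * (1 - (Real.sqrt L)⁻¹)⁻¹ * ((L : ℝ) ^ 2 / 4) * 2
      * (((L : ℝ) ^ (3 : ℕ))⁻¹ * (3 * ((2 : ℕ) : ℝ) * (((L * L + L - 1 : ℕ) : ℝ) + 1) ^ 2 * (((3 : ℕ) : ℝ) * (((3 : ℕ) : ℝ) * ((2 : ℕ) : ℝ) ^ (3 : ℕ))))))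
      + (Real.sqrt L)⁻¹ * (2 * (1 - (Real.sqrt L)⁻¹)⁻¹ * 2 * (((2 : ℕ) : ℝ) / 2 * ((3 : ℕ) : ℝ) ^ 2 * ((L : ℝ) - 1) ^ 2 * (L : ℝ) ^ 2 * ((3 : ℕ) : ℝ))))) := ⟨_, rfl⟩
  obtain ⟨wN, hwNdef⟩ : ∃ w : ℝ, w = 8 * ((3 : ℕ) : ℝ) * (3 * ((Real.sqrt L)⁻¹ * (((3 : ℕ) : ℝ) * ((L : ℝ) ^ 2 / 4) * (2 * ((L : ℝ) ^ (3 : ℕ))⁻¹ * (L : ℝ) * (L : ℝ)))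
      + (L : ℝ)⁻¹ * (2 * ((3 : ℕ) : ℝ) * (1 - (Real.sqrt L)⁻¹)⁻¹ * ((L : ℝ) ^ 2 / 4) * 2
      * (((L : ℝ) ^ (3 : ℕ))⁻¹ * (3 * ((2 : ℕ) : ℝ) * (((L * L + L - 1 : ℕ) : ℝ) + 1) ^ 2 * (((3 : ℕ) : ℝ) * (((3 : ℕ) : ℝ) * ((2 : ℕ) : ℝ) ^ (3 : ℕ))))))
      + (Real.sqrt L)⁻¹ * (2 * (1 - (Real.sqrt L)⁻¹)⁻¹ * 2 * (((2 : ℕ) : ℝ) / 2 * ((3 : ℕ) : ℝ) ^ 2 * ((L : ℝ) - 1) ^ 2 * (L : ℝ) ^ 2 * ((3 : ℕ) : ℝ))))) := ⟨_, rfl⟩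
  obtain ⟨wS, hwSdef⟩ : ∃ w : ℝ, w = 2 * (3 * ((L : ℝ)⁻¹ * (2 * ((3 : ℕ) : ℝ) * (1 - (Real.sqrt L)⁻¹)⁻¹ * ((L : ℝ) ^ 2 / 4) * 2 * (3 * ((L : ℝ) ^ 2)⁻¹ * ((L : ℝ) ^ (3 : ℕ))⁻¹ * ((3 : ℕ) : ℝ))))) := ⟨_, rfl⟩
  obtain ⟨a₁, ha₁⟩ : ∃ t : ℝ, t = 2 * (2 * (10 ^ 7 * (L : ℝ) ^ 3)⁻¹) := ⟨_, rfl⟩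
  obtain ⟨ΘM, hΘMdef⟩ : ∃ w : ℝ, w = (2 * (3 * ((Real.sqrt L)⁻¹ * (((3 : ℕ) : ℝ) * ((L : ℝ) ^ 2 / 4)
      * (2 * ((L : ℝ) ^ (3 : ℕ))⁻¹ * (8 * ((((3 : ℕ) : ℝ) + 1) * (L : ℝ)) ^ 2 * 1 + 8 * (2 * (8 * (((3 : ℕ) : ℝ) + 1) * (((3 : ℕ) : ℝ) + 4) * (L : ℝ) ^ 2))) ^ 2 * ((3 : ℕ) : ℝ)))
      + (L : ℝ)⁻¹ * (2 * ((3 : ℕ) : ℝ) * (1 - (Real.sqrt L)⁻¹)⁻¹ * ((L : ℝ) ^ 2 / 4) * 2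
      * (((L : ℝ) ^ (3 : ℕ))⁻¹ * ((12 * ((2 : ℕ) : ℝ) * (((L * L + L - 1 : ℕ) : ℝ) + 1) ^ 2 * ((3 : ℕ) : ℝ) ^ 3 * ((L * L + L - 1 : ℕ) : ℝ) ^ 2 * 1 ^ 2
      + 3 * (2 * ((3 : ℕ) : ℝ) * L * (4 * (2 * (8 * (((3 : ℕ) : ℝ) + 1) * (((3 : ℕ) : ℝ) + 4) * (L : ℝ) ^ 2))) + 2 * ((3 * ((3 : ℕ) : ℝ) + 1) * (L * L + L - 1 : ℕ) : ℝ) ^ 2 * 1) ^ 2) * (((3 : ℕ) : ℝ) * (((3 : ℕ) : ℝ) * ((2 : ℕ) : ℝ) ^ (3 : ℕ))))))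
      + (Real.sqrt L)⁻¹ * (2 * (1 - (Real.sqrt L)⁻¹)⁻¹ * 2
      * ((8 * ((3 : ℕ) : ℝ) ^ 6 * ((L : ℝ) - 1) ^ 6 + 2 * ((2 : ℕ) : ℝ) * ((3 : ℕ) : ℝ) ^ 5 * ((L : ℝ) - 1) ^ 4 * (L : ℝ) ^ 2) * 1 ^ 2 * ((3 : ℕ) : ℝ)))))
      + 4 * (3 * ((L : ℝ)⁻¹ * (2 * ((3 : ℕ) : ℝ) * (1 - (Real.sqrt L)⁻¹)⁻¹ * ((L : ℝ) ^ 2 / 4) * 2 * (3 * ((L : ℝ) ^ 2)⁻¹ * ((L : ℝ) ^ (3 : ℕ))⁻¹ * ((3 : ℕ) : ℝ)))))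
      * ((210 * ((2 * ((3 : ℕ) : ℝ) + 2) * L)) ^ 2 * (2 * (8 * (((3 : ℕ) : ℝ) + 1) * (((3 : ℕ) : ℝ) + 4) * (L : ℝ) ^ 2)) ^ 2 * (2 * ((3 : ℕ) : ℝ)))) * a₁ ^ 2 := ⟨_, rfl⟩
  have hwG : 0 ≤ wG := by rw [hwGdef]; exact wG_choice_nonneg L 3 2 (L * L + L - 1) 2 hL
  have hwN : 0 ≤ wN := by rw [hwNdef]; exact wN_choice_nonneg L 3 2 (L * L + L - 1) 2 hL
  have hwS : 0 ≤ wS := by rw [hwSdef]; exact wS_choice_nonneg L 3 hL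
  have hΘM : 0 ≤ ΘM := by
    rw [hΘMdef]; exact mul_nonneg (ThetaM_choice_nonneg L 3 2 (L * L + L - 1) 2 hL _) (sq_nonneg _)
  -- the frozen letters at `eC` (✓1b)
  obtain ⟨eC, ε₀C, δC, θ'C, θgC, θ₂C, cB1C, heC, hε₀C, hδC, hθ'C, hθgC, hθ₂C, hcB1C, ⟨hρ0, hρ1⟩, ⟨hθ'0, hθg0, hθ₂0, hcB10⟩,
    hsmall, hsmallS, hrad⟩ := frozen_letters (L : ℝ) B₁' wN wS ΘM hL1r hB₁' hwS
  have hρ2 : ((Real.sqrt (L : ℝ))⁻¹) ^ 2 < 1 := pow_lt_one₀ hρ0.le hρ1 (by norm_num)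
  have hΨ : 0 ≤ (Real.sqrt (L : ℝ))⁻¹ / (1 - (Real.sqrt (L : ℝ))⁻¹) := div_nonneg hρ0.le (by linarith)
  obtain ⟨E, hE⟩ : ∃ t : ℝ, t = Real.exp (θ'C * (((Real.sqrt (L : ℝ))⁻¹) ^ 3 / (1 - ((Real.sqrt (L : ℝ))⁻¹) ^ 4))) := ⟨_, rfl⟩
  obtain ⟨CcA, hCcA⟩ : ∃ t : ℝ, t = Real.sqrt (2 * (ΘM + 3 * wS * θ₂C ^ 2) * ((Real.sqrt (L : ℝ))⁻¹ / (1 - (Real.sqrt (L : ℝ))⁻¹))) := ⟨_, rfl⟩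
  obtain ⟨CA, hCA⟩ : ∃ t : ℝ, t = E * (1 + CcA) * (1 + (1 + cB1C) * (2 * E * θ₂C * ((Real.sqrt (L : ℝ))⁻¹ / (1 - ((Real.sqrt (L : ℝ))⁻¹) ^ 2)))) := ⟨_, rfl⟩
  obtain ⟨CB, hCB⟩ : ∃ t : ℝ, t = 1 + (1 + cB1C) * (2 * E * θ₂C * (((Real.sqrt (L : ℝ))⁻¹) ^ 3 / (1 - ((Real.sqrt (L : ℝ))⁻¹) ^ 4))) := ⟨_, rfl⟩
  obtain ⟨c₀, hc₀⟩ : ∃ t : ℝ, t = 2 * wG * ((Real.sqrt (L : ℝ))⁻¹ / (1 - (Real.sqrt (L : ℝ))⁻¹)) := ⟨_, rfl⟩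
  obtain ⟨CG, hCG⟩ : ∃ t : ℝ, t = θgC * E * (((Real.sqrt (L : ℝ))⁻¹) ^ 3 / (1 - ((Real.sqrt (L : ℝ))⁻¹) ^ 2)) := ⟨_, rfl⟩
  obtain ⟨cX, hcX⟩ : ∃ t : ℝ, t = 384 * ε₀C ^ 2 + 12 * ε₀C + 60 * δC ^ 2 := ⟨_, rfl⟩
  have hc₀0 : 0 ≤ c₀ := by rw [hc₀]; positivity
  have hε₀C0 : 0 ≤ ε₀C := by rw [hε₀C]; positivity
  have hδC0 : 0 ≤ δC := by rw [hδC]; positivity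
  have hcX0 : 0 ≤ cX := by rw [hcX]; positivity
  obtain ⟨hA0, hB0, hB'0⟩ := hMc_constants_nonneg (CA := CA) (CB := CB) (CG := CG) hc₀0 hcX0
  refine ⟨eC, 2 * CA ^ 2, 32 * CB ^ 2 * c₀, 4 * CB ^ 2 * c₀ * (cX + CG ^ 2), heC, hA0, hB0, hB'0, ?_⟩
  -- ===== the member =====
  intro F hF n K hnK ee V W X he heE hW _ h19 _ _ l hl
  letI : CStarAlgebra (Matrix (Fin 2) (Fin 2) ℂ) := B10Eq29TubeLine.cstarAlgebraMatrix 2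
  obtain ⟨hten7, hδε, hδ0, heε, hεle, hδle⟩ := hrad ee he heE
  have hFL : (F.L : ℝ) = (L : ℝ) := by exact_mod_cast hF
  have hPL : (F.P K).L = L := hF
  have hPLr : ((F.P K).L : ℝ) = (L : ℝ) := by exact_mod_cast hPL
  have hd : (F.P K).d = 3 := T3Family.P_d F K
  have hε₀ : 0 < (12 * B₁' + 1) * ee := by positivity
  have hten7F : 10 ^ 7 * (F.L : ℝ) ^ 3 * ((12 * B₁' + 1) * ee) ≤ 1 := by rw [hFL]; exact hten7
  have hreg : RegPr F n K ((12 * B₁' + 1) * ee) W := regPr_mono F heε ((mem_regFibrePr_iff F).mp hW).2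
  have hKn : K - n ≤ F.m + K := by omega
  have hL1 : 1 ≤ (F.P K).L := by rw [hPL]; omega
  have hpert := comb_tower_pert_rows_of_regPr_of_in19 F hε₀ hten7F hreg hδ0 hδε h19
  have hNtop : (F.P K).sitesPerDir (K - n) * (F.P K).L ^ (K - n) = (F.P K).sitesPerDir 0 := sitesPerDir_T3_mul_pow F K hKn
  have hN'pos : 0 < (F.P K).sitesPerDir (K - n) := by rw [sitesPerDir_T3]; have := F.hL.2; positivity
  have hU₀p : IsPeriodic ((F.P K).sitesPerDir (K - n) * (F.P K).L ^ (K - n)) (pull (bgUnits F K W) (basePt F n K)) := by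
    rw [hNtop]; exact isPeriodic_pull _ _
  have hU₁p : IsPeriodic ((F.P K).sitesPerDir (K - n) * (F.P K).L ^ (K - n)) (pull (fun b => expUnit (Complex.I • X b)) (basePt F n K)) := by
    rw [hNtop]; exact isPeriodic_pull _ _
  -- ===== the tower's letters at the member (opaque, with equations) =====
  obtain ⟨af, haf⟩ : ∃ f : ℕ → ℝ, f = fun j => 2 * (2 * ((12 * B₁' + 1) * ee) * ((((F.P K).L : ℝ)) ^ j * ((((F.P K).L : ℝ)) ^ (K - n))⁻¹) ^ 2) :=
    ⟨_, rfl⟩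
  obtain ⟨αf, hαf⟩ : ∃ f : ℕ → ℝ, f = fun j => 2 * (8 * (((F.P K).d : ℝ) + 1) * (((F.P K).d : ℝ) + 4) * ((F.P K).L : ℝ) ^ 2 * af j) := ⟨_, rfl⟩
  obtain ⟨μf, hμf⟩ : ∃ f : ℕ → ℝ, f = fun j => 9360 * (F.L : ℝ) ^ 3 * ((F.L : ℝ) ^ j * ((2 * B₁' * ee) * eta F n K)) := ⟨_, rfl⟩
  obtain ⟨Yt, hYt⟩ : ∃ f : ℕ → LSite (F.P K).d → Fin (F.P K).d → Matrix (Fin 2) (Fin 2) ℂ, f = fun i x μ' =>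
      ((tildIter (F.P K).L (pull (bgUnits F K W) (basePt F n K)) (pull (fun b => expUnit (Complex.I • X b)) (basePt F n K)) i x μ'
        : (Matrix (Fin 2) (Fin 2) ℂ)ˣ) : Matrix (Fin 2) (Fin 2) ℂ) - 1 := ⟨_, rfl⟩
  have hYt' : ∀ (i : ℕ) (x : LSite (F.P K).d) (μ' : Fin (F.P K).d), Yt i x μ'
      = ((tildIter (F.P K).L (pull (bgUnits F K W) (basePt F n K)) (pull (fun b => expUnit (Complex.I • X b)) (basePt F n K)) i x μ'
        : (Matrix (Fin 2) (Fin 2) ℂ)ˣ) : Matrix (Fin 2) (Fin 2) ℂ) - 1 := fun i x μ' => by rw [hYt]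
  have haf' : ∀ j, af j = 2 * (2 * ((12 * B₁' + 1) * ee) * ((((F.P K).L : ℝ)) ^ j * ((((F.P K).L : ℝ)) ^ (K - n))⁻¹) ^ 2) := fun j => by rw [haf]
  have hαf' : ∀ j, αf j = 2 * (8 * (((F.P K).d : ℝ) + 1) * (((F.P K).d : ℝ) + 4) * ((F.P K).L : ℝ) ^ 2 * af j) := fun j => by rw [hαf]
  have hμf' : ∀ j, μf j = 9360 * (F.L : ℝ) ^ 3 * ((F.L : ℝ) ^ j * ((2 * B₁' * ee) * eta F n K)) := fun j => by rw [hμf]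
  have ha0 : ∀ j, 0 ≤ af j := fun j => by rw [haf']; positivity
  have hα0 : ∀ j, 0 ≤ αf j := fun j => by rw [hαf']; have := ha0 j; positivity
  have hμ0 : ∀ j, 0 ≤ μf j := fun j => by rw [hμf']; have := eta_pos F n K; positivity
  have hα24 : ∀ j < K - n, αf j ≤ 1 / 24 := fun j hj => by
    rw [hαf', haf']; exact (alpha_level_le_window F hε₀ hten7F W hreg hj.le).trans (by norm_num)
  have hμ72 : ∀ j < K - n, 72 * μf j ≤ 1 := fun j hj => by rw [hμf']; exact (hpert j hj.le).2.2.2.2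
  -- ===== the three families (✓F-8b-1, zero content) =====
  obtain ⟨rem, hremdef⟩ : ∃ f : ℕ → LSite (F.P K).d → Fin (F.P K).d → Matrix (Fin 2) (Fin 2) ℂ, f = fun j z κ => Yt (j + 1) z κ
      - (fderiv ℂ (eml : ((Fin (F.P K).d → Fin (F.P K).L) → Matrix (Fin 2) (Fin 2) ℂ) → Matrix (Fin 2) (Fin 2) ℂ)
            (fun r => ((Wcx (F.P K).L (avgIter (F.P K).L (pull (bgUnits F K W) (basePt F n K)) j) (((F.P K).L : ℤ) • z) κ (boxVec (F.P K).L r)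
              : (Matrix (Fin 2) (Fin 2) ℂ)ˣ) : Matrix (Fin 2) (Fin 2) ℂ))
            (fun r => tsum (avgIter (F.P K).L (pull (bgUnits F K W) (basePt F n K)) j) (Yt j) (((F.P K).L : ℤ) • z)
                (gammaWord (F.P K).L κ (boxVec (F.P K).L r) ++ seg κ (-((F.P K).L : ℤ)))
              * ((Wcx (F.P K).L (avgIter (F.P K).L (pull (bgUnits F K W) (basePt F n K)) j) (((F.P K).L : ℤ) • z) κ (boxVec (F.P K).L r)
                : (Matrix (Fin 2) (Fin 2) ℂ)ˣ) : Matrix (Fin 2) (Fin 2) ℂ))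
            * (((expUnit (Xavg (F.P K).L (avgIter (F.P K).L (pull (bgUnits F K W) (basePt F n K)) j) (((F.P K).L : ℤ) • z) κ))⁻¹
                : (Matrix (Fin 2) (Fin 2) ℂ)ˣ) : Matrix (Fin 2) (Fin 2) ℂ)
          + ((expUnit (Xavg (F.P K).L (avgIter (F.P K).L (pull (bgUnits F K W) (basePt F n K)) j) (((F.P K).L : ℤ) • z) κ)
                : (Matrix (Fin 2) (Fin 2) ℂ)ˣ) : Matrix (Fin 2) (Fin 2) ℂ)
            * tsum (avgIter (F.P K).L (pull (bgUnits F K W) (basePt F n K)) j) (Yt j) (((F.P K).L : ℤ) • z) (seg κ ((F.P K).L : ℤ))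
            * (((expUnit (Xavg (F.P K).L (avgIter (F.P K).L (pull (bgUnits F K W) (basePt F n K)) j) (((F.P K).L : ℤ) • z) κ))⁻¹
                : (Matrix (Fin 2) (Fin 2) ℂ)ˣ) : Matrix (Fin 2) (Fin 2) ℂ)) := ⟨_, rfl⟩
  obtain ⟨Glin, -, hG0, -, hGlin, -⟩ := exists_sourced_reduced_family (F.P K).L (pull (bgUnits F K W) (basePt F n K)) (Yt 0)
    (fun j X' y => FhatCov (F.P K).L (avgIter (F.P K).L (pull (bgUnits F K W) (basePt F n K)) j) X' (((F.P K).L : ℤ) • y)) (fun _ _ _ => 0)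
  obtain ⟨Nn, -, hN0, -, hNn, -⟩ := exists_sourced_reduced_family (F.P K).L (pull (bgUnits F K W) (basePt F n K)) 0
    (fun j X' y => FhatCov (F.P K).L (avgIter (F.P K).L (pull (bgUnits F K W) (basePt F n K)) j) X' (((F.P K).L : ℤ) • y)) rem
  obtain ⟨Λ, hΛ0, hΛs⟩ := exists_gauge_family (𝔸 := Matrix (Fin 2) (Fin 2) ℂ) (F.P K).L
    (fun j X' y => FhatCov (F.P K).L (avgIter (F.P K).L (pull (bgUnits F K W) (basePt F n K)) j) X' (((F.P K).L : ℤ) • y)) (fun j => Glin j + Nn j)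
  -- ===== the five cell letters (opaque) =====
  obtain ⟨mf, hmf⟩ : ∃ f : ℕ → ℝ, f = fun j => Real.sqrt (∑ t : Fin (F.P K).d → Fin ((F.P K).sitesPerDir (K - n) * (F.P K).L ^ (K - n - j)),
      ∑ μ' : Fin (F.P K).d, ‖Glin j (boxVec ((F.P K).sitesPerDir (K - n) * (F.P K).L ^ (K - n - j)) t) μ'‖ ^ 2) := ⟨_, rfl⟩
  obtain ⟨nf, hnf⟩ : ∃ f : ℕ → ℝ, f = fun j => Real.sqrt (∑ t : Fin (F.P K).d → Fin ((F.P K).sitesPerDir (K - n) * (F.P K).L ^ (K - n - j)),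
      ∑ μ' : Fin (F.P K).d, ‖Nn j (boxVec ((F.P K).sitesPerDir (K - n) * (F.P K).L ^ (K - n - j)) t) μ'‖ ^ 2) := ⟨_, rfl⟩
  obtain ⟨yf, hyf⟩ : ∃ f : ℕ → ℝ, f = fun j => Real.sqrt (∑ t : Fin (F.P K).d → Fin ((F.P K).sitesPerDir (K - n) * (F.P K).L ^ (K - n - j)),
      ∑ μ' : Fin (F.P K).d, ‖Yt j (boxVec ((F.P K).sitesPerDir (K - n) * (F.P K).L ^ (K - n - j)) t) μ'‖ ^ 2) := ⟨_, rfl⟩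
  obtain ⟨gf, hgf⟩ : ∃ f : ℕ → ℝ, f = fun j => Real.sqrt (∑ t : Fin (F.P K).d → Fin ((F.P K).sitesPerDir (K - n) * (F.P K).L ^ (K - n - j)),
      ∑ κ : Fin (F.P K).d, ∑ ν : Fin (F.P K).d,
        ‖conjR (avgIter (F.P K).L (pull (bgUnits F K W) (basePt F n K)) j (boxVec ((F.P K).sitesPerDir (K - n) * (F.P K).L ^ (K - n - j)) t) ν)
            (Glin j (boxVec ((F.P K).sitesPerDir (K - n) * (F.P K).L ^ (K - n - j)) t + e ν) κ)
          - Glin j (boxVec ((F.P K).sitesPerDir (K - n) * (F.P K).L ^ (K - n - j)) t) κ‖ ^ 2) := ⟨_, rfl⟩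
  obtain ⟨lamf, hlamf⟩ : ∃ f : ℕ → ℝ, f = fun j => Real.sqrt (∑ t : Fin (F.P K).d → Fin ((F.P K).sitesPerDir (K - n) * (F.P K).L ^ (K - n - j)),
      ∑ κ : Fin (F.P K).d, ‖Λ j (boxVec ((F.P K).sitesPerDir (K - n) * (F.P K).L ^ (K - n - j)) t)
        - conjR (avgIter (F.P K).L (pull (bgUnits F K W) (basePt F n K)) j (boxVec ((F.P K).sitesPerDir (K - n) * (F.P K).L ^ (K - n - j)) t) κ)
            (Λ j (boxVec ((F.P K).sitesPerDir (K - n) * (F.P K).L ^ (K - n - j)) t + e κ))‖ ^ 2) := ⟨_, rfl⟩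
  have hm00 : 0 ≤ mf 0 := by rw [hmf]; exact Real.sqrt_nonneg _
  have hg00 : 0 ≤ gf 0 := by rw [hgf]; exact Real.sqrt_nonneg _
  -- ===== the `ρ` letters (d = 3) and the two `m₀`∕`g₀`-dependent constants =====
  have hρm : Real.sqrt (((F.P K).L : ℝ) ^ 2 * (((F.P K).L : ℝ) ^ (F.P K).d)⁻¹) = (Real.sqrt (L : ℝ))⁻¹ := by
    rw [hd, hPLr]; exact (rho_letters_T3 hL0r).1
  have hρg : Real.sqrt (((F.P K).L : ℝ) ^ 4 * (((F.P K).L : ℝ) ^ (F.P K).d)⁻¹) = ((Real.sqrt (L : ℝ))⁻¹)⁻¹ := by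
    rw [hd, hPLr]; exact (rho_letters_T3 hL0r).2
  have hK32 : 0 ≤ ((Real.sqrt (L : ℝ))⁻¹) ^ 3 / (1 - ((Real.sqrt (L : ℝ))⁻¹) ^ 2) := div_nonneg (by positivity) (by linarith)
  obtain ⟨cA, hcAdef⟩ : ∃ t : ℝ, t = Real.sqrt (2 * (ΘM + 3 * wS * θ₂C ^ 2) * ((Real.sqrt (L : ℝ))⁻¹ / (1 - (Real.sqrt (L : ℝ))⁻¹)))
      * (Real.exp (θ'C * (((Real.sqrt (L : ℝ))⁻¹) ^ 3 / (1 - ((Real.sqrt (L : ℝ))⁻¹) ^ 4))) * mf 0) := ⟨_, rfl⟩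
  obtain ⟨cB0, hcB0def⟩ : ∃ t : ℝ, t = Real.sqrt (2 * wG * ((Real.sqrt (L : ℝ))⁻¹ / (1 - (Real.sqrt (L : ℝ))⁻¹)))
      * (gf 0 + θgC * Real.exp (θ'C * (((Real.sqrt (L : ℝ))⁻¹) ^ 3 / (1 - ((Real.sqrt (L : ℝ))⁻¹) ^ 4))) * mf 0
          * ((Real.sqrt (L : ℝ))⁻¹) ^ (2 * (K - n)) * (((Real.sqrt (L : ℝ))⁻¹) ^ 3 / (1 - ((Real.sqrt (L : ℝ))⁻¹) ^ 2))) := ⟨_, rfl⟩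
  have hcA0 : 0 ≤ cA := by rw [hcAdef]; exact sqrt_mul_nonneg (mul_nonneg (Real.exp_pos _).le hm00)
  have hcB00 : 0 ≤ cB0 := by
    rw [hcB0def]
    exact sqrt_mul_nonneg (add_nonneg hg00 (mul_nonneg (mul_nonneg (mul_nonneg (mul_nonneg hθg0 (Real.exp_pos _).le) hm00)
      (pow_nonneg hρ0.le _)) hK32))
  -- ===== the geometric rows with the frozen letters (✓1a §5) =====
  have haC : ∀ j < K - n, af j ≤ 2 * (2 * ε₀C) * ((Real.sqrt (L : ℝ))⁻¹) ^ (4 * (K - n - j)) := fun j hj => by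
    rw [haf', hPLr]; exact a_level_le_frozen hL0r hεle hj.le
  have hμC : ∀ j < K - n, μf j ≤ 9360 * (L : ℝ) ^ 3 * δC * ((Real.sqrt (L : ℝ))⁻¹) ^ (2 * (K - n - j)) := fun j hj => by
    rw [hμf', mu_level_eq_inv_pow F (n := n) (K := K) hj.le, hFL]; exact mu_level_le_frozen hL0r (by positivity) hδle j (K - n)
  -- ===== the cell weights at the member (5b-1's domination rows by equality) =====
  have hL2F : 2 ≤ (F.P K).L := (F.P K).hL.2
  obtain ⟨wM, hwMdef⟩ : ∃ f : ℕ → ℝ, f = fun i => 2 * (3 * ((Real.sqrt ((F.P K).L : ℝ))⁻¹ * (((F.P K).d : ℝ) * (((F.P K).L : ℝ) ^ 2 / 4)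
    * (2 * (((F.P K).L : ℝ) ^ (F.P K).d)⁻¹ * (8 * ((((F.P K).d : ℝ) + 1) * ((F.P K).L : ℝ)) ^ 2 * af i + 8 * αf i) ^ 2 * ((F.P K).d : ℝ)))
    + ((F.P K).L : ℝ)⁻¹ * (2 * ((F.P K).d : ℝ) * (1 - (Real.sqrt ((F.P K).L : ℝ))⁻¹)⁻¹ * (((F.P K).L : ℝ) ^ 2 / 4) * 2
    * ((((F.P K).L : ℝ) ^ (F.P K).d)⁻¹ * ((12 * ((2 : ℕ) : ℝ) * (((L * L + L - 1 : ℕ) : ℝ) + 1) ^ 2 * ((F.P K).d : ℝ) ^ 3 * ((L * L + L - 1 : ℕ) : ℝ) ^ 2 * af i ^ 2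
    + 3 * (2 * ((F.P K).d : ℝ) * ((F.P K).L : ℝ) * (4 * αf i) + 2 * ((3 * ((F.P K).d : ℝ) + 1) * (L * L + L - 1 : ℕ) : ℝ) ^ 2 * af i) ^ 2) * (((F.P K).d : ℝ) * (((F.P K).d : ℝ) * ((2 : ℕ) : ℝ) ^ (F.P K).d)))))
    + (Real.sqrt ((F.P K).L : ℝ))⁻¹ * (2 * (1 - (Real.sqrt ((F.P K).L : ℝ))⁻¹)⁻¹ * 2
    * ((8 * ((F.P K).d : ℝ) ^ 6 * (((F.P K).L : ℝ) - 1) ^ 6 + 2 * ((2 : ℕ) : ℝ) * ((F.P K).d : ℝ) ^ 5 * (((F.P K).L : ℝ) - 1) ^ 4 * ((F.P K).L : ℝ) ^ 2) * af i ^ 2 * ((F.P K).d : ℝ)))))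
    + 4 * (3 * (((F.P K).L : ℝ)⁻¹ * (2 * ((F.P K).d : ℝ) * (1 - (Real.sqrt ((F.P K).L : ℝ))⁻¹)⁻¹ * (((F.P K).L : ℝ) ^ 2 / 4) * 2 * (3 * (((F.P K).L : ℝ) ^ 2)⁻¹ * (((F.P K).L : ℝ) ^ (F.P K).d)⁻¹ * ((F.P K).d : ℝ)))))
    * ((210 * ((2 * ((F.P K).d : ℝ) + 2) * ((F.P K).L : ℝ))) ^ 2 * αf i ^ 2 * (2 * ((F.P K).d : ℝ))) := ⟨_, rfl⟩
  have hwM0 : ∀ j, 0 ≤ wM j := fun j => by rw [hwMdef]; exact wM_choice_nonneg (F.P K).L (F.P K).d 2 (L * L + L - 1) 2 hL2F af αf j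
  have hαa : ∀ j, αf j ≤ (2 * (8 * (((F.P K).d : ℝ) + 1) * (((F.P K).d : ℝ) + 4) * ((F.P K).L : ℝ) ^ 2)) * af j :=
    fun j => le_of_eq (by rw [hαf']; ring)
  have hε₀C1 : ε₀C ≤ (10 ^ 7 * (L : ℝ) ^ 3)⁻¹ := by
    have hpos : (0 : ℝ) < 10 ^ 7 * (L : ℝ) ^ 3 := by positivity
    obtain ⟨h10, -, -, -, -, -⟩ := hrad eC heC le_rfl
    rw [inv_eq_one_div, le_div_iff₀ hpos, hε₀C]; linarith
  have haC₁ : ∀ j < K - n, af j ≤ a₁ * ((Real.sqrt (L : ℝ))⁻¹) ^ (4 * (K - n - j)) := fun j hj =>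
    (haC j hj).trans (mul_le_mul_of_nonneg_right (by rw [ha₁]; linarith) (by positivity))
  have hwMgeo : ∀ j < K - n, wM j ≤ ΘM * ((Real.sqrt (L : ℝ))⁻¹) ^ (4 * (K - n - j)) := by
    intro j hj
    have h := wM_choice_geo (F.P K).L (F.P K).d 2 (L * L + L - 1) 2 hL2F hρ0.le hρ1.le af αf ha0 hα0 hαa haC₁ j hj
    rw [hwMdef]; dsimp only
    rw [hΘMdef]
    rw [hd, hPLr] at h ⊢
    exact h
  have hρs : Real.sqrt (((F.P K).L : ℝ)) = ((Real.sqrt (L : ℝ))⁻¹)⁻¹ := by rw [hPLr, inv_inv]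
  obtain ⟨hnC, hnA⟩ := numerals_nC_AC (show 1 ≤ L by omega)
  have hdomG : 2 * (3 * ((Real.sqrt ((F.P K).L : ℝ))⁻¹ * (((F.P K).d : ℝ) * (((F.P K).L : ℝ) ^ 2 / 4) * (2 * (((F.P K).L : ℝ) ^ (F.P K).d)⁻¹ * ((F.P K).L : ℝ) * ((F.P K).L : ℝ)))
      + ((F.P K).L : ℝ)⁻¹ * (2 * ((F.P K).d : ℝ) * (1 - (Real.sqrt ((F.P K).L : ℝ))⁻¹)⁻¹ * (((F.P K).L : ℝ) ^ 2 / 4) * 2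
      * ((((F.P K).L : ℝ) ^ (F.P K).d)⁻¹ * (3 * ((2 : ℕ) : ℝ) * (((L * L + L - 1 : ℕ) : ℝ) + 1) ^ 2 * (((F.P K).d : ℝ) * (((F.P K).d : ℝ) * ((2 : ℕ) : ℝ) ^ (F.P K).d)))))
      + (Real.sqrt ((F.P K).L : ℝ))⁻¹ * (2 * (1 - (Real.sqrt ((F.P K).L : ℝ))⁻¹)⁻¹ * 2 * (((2 : ℕ) : ℝ) / 2 * ((F.P K).d : ℝ) ^ 2 * (((F.P K).L : ℝ) - 1) ^ 2 * ((F.P K).L : ℝ) ^ 2 * ((F.P K).d : ℝ))))) ≤ wG := by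
    rw [hwGdef]; rw [hd, hPLr]
  have hdomN : 8 * ((F.P K).d : ℝ) * (3 * ((Real.sqrt ((F.P K).L : ℝ))⁻¹ * (((F.P K).d : ℝ) * (((F.P K).L : ℝ) ^ 2 / 4) * (2 * (((F.P K).L : ℝ) ^ (F.P K).d)⁻¹ * ((F.P K).L : ℝ) * ((F.P K).L : ℝ)))
      + ((F.P K).L : ℝ)⁻¹ * (2 * ((F.P K).d : ℝ) * (1 - (Real.sqrt ((F.P K).L : ℝ))⁻¹)⁻¹ * (((F.P K).L : ℝ) ^ 2 / 4) * 2
      * ((((F.P K).L : ℝ) ^ (F.P K).d)⁻¹ * (3 * ((2 : ℕ) : ℝ) * (((L * L + L - 1 : ℕ) : ℝ) + 1) ^ 2 * (((F.P K).d : ℝ) * (((F.P K).d : ℝ) * ((2 : ℕ) : ℝ) ^ (F.P K).d)))))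
      + (Real.sqrt ((F.P K).L : ℝ))⁻¹ * (2 * (1 - (Real.sqrt ((F.P K).L : ℝ))⁻¹)⁻¹ * 2 * (((2 : ℕ) : ℝ) / 2 * ((F.P K).d : ℝ) ^ 2 * (((F.P K).L : ℝ) - 1) ^ 2 * ((F.P K).L : ℝ) ^ 2 * ((F.P K).d : ℝ))))) ≤ wN := by
    rw [hwNdef]; rw [hd, hPLr]
  have hdomS : 2 * (3 * (((F.P K).L : ℝ)⁻¹ * (2 * ((F.P K).d : ℝ) * (1 - (Real.sqrt ((F.P K).L : ℝ))⁻¹)⁻¹ * (((F.P K).L : ℝ) ^ 2 / 4) * 2 * (3 * (((F.P K).L : ℝ) ^ 2)⁻¹ * (((F.P K).L : ℝ) ^ (F.P K).d)⁻¹ * ((F.P K).d : ℝ))))) ≤ wS := by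
    rw [hwSdef]; rw [hd, hPLr]
  have hdomM : ∀ i < K - n, 2 * (3 * ((Real.sqrt ((F.P K).L : ℝ))⁻¹ * (((F.P K).d : ℝ) * (((F.P K).L : ℝ) ^ 2 / 4)
      * (2 * (((F.P K).L : ℝ) ^ (F.P K).d)⁻¹ * (8 * ((((F.P K).d : ℝ) + 1) * ((F.P K).L : ℝ)) ^ 2 * af i + 8 * αf i) ^ 2 * ((F.P K).d : ℝ)))
      + ((F.P K).L : ℝ)⁻¹ * (2 * ((F.P K).d : ℝ) * (1 - (Real.sqrt ((F.P K).L : ℝ))⁻¹)⁻¹ * (((F.P K).L : ℝ) ^ 2 / 4) * 2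
      * ((((F.P K).L : ℝ) ^ (F.P K).d)⁻¹ * ((12 * ((2 : ℕ) : ℝ) * (((L * L + L - 1 : ℕ) : ℝ) + 1) ^ 2 * ((F.P K).d : ℝ) ^ 3 * ((L * L + L - 1 : ℕ) : ℝ) ^ 2 * af i ^ 2
      + 3 * (2 * ((F.P K).d : ℝ) * ((F.P K).L : ℝ) * (4 * αf i) + 2 * ((3 * ((F.P K).d : ℝ) + 1) * (L * L + L - 1 : ℕ) : ℝ) ^ 2 * af i) ^ 2) * (((F.P K).d : ℝ) * (((F.P K).d : ℝ) * ((2 : ℕ) : ℝ) ^ (F.P K).d)))))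
      + (Real.sqrt ((F.P K).L : ℝ))⁻¹ * (2 * (1 - (Real.sqrt ((F.P K).L : ℝ))⁻¹)⁻¹ * 2
      * ((8 * ((F.P K).d : ℝ) ^ 6 * (((F.P K).L : ℝ) - 1) ^ 6 + 2 * ((2 : ℕ) : ℝ) * ((F.P K).d : ℝ) ^ 5 * (((F.P K).L : ℝ) - 1) ^ 4 * ((F.P K).L : ℝ) ^ 2) * af i ^ 2 * ((F.P K).d : ℝ)))))
      + 4 * (3 * (((F.P K).L : ℝ)⁻¹ * (2 * ((F.P K).d : ℝ) * (1 - (Real.sqrt ((F.P K).L : ℝ))⁻¹)⁻¹ * (((F.P K).L : ℝ) ^ 2 / 4) * 2 * (3 * (((F.P K).L : ℝ) ^ 2)⁻¹ * (((F.P K).L : ℝ) ^ (F.P K).d)⁻¹ * ((F.P K).d : ℝ)))))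
      * ((210 * ((2 * ((F.P K).d : ℝ) + 2) * ((F.P K).L : ℝ))) ^ 2 * αf i ^ 2 * (2 * ((F.P K).d : ℝ))) ≤ wM i := fun i _ => (congrFun hwMdef i).ge
  -- ===== the cell theorem (✓F-8b-4 v2; its gauge row `hrow` = ★routeR-w6 g9's F-8b-5b-1 `gauge_row_inhabited` at the member) =====
  have hcell := sum_cell_normSq_tild_le_two_slot ((F.P K).L) ((F.P K).sitesPerDir (K - n)) (K - n) hL1 hN'pos
    (pull (bgUnits F K W) (basePt F n K)) (pull (fun b => expUnit (Complex.I • X b)) (basePt F n K)) hU₀p hU₁p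
    (fun j hj x μ => avgIter_pull_mem_unitaryUnits_of_regPr F hε₀ hten7F W hreg hj x μ)
    (fun j hj x μ => unitaryUnits_le_U1 ((hpert j hj.le).1 x μ)) αf af μf hα0 hα24
    (fun j hj z κ r => by rw [hαf', haf']; exact norm_Wcx_avgIter_pull_sub_one_le_level_of_regPr F hε₀ hten7F W hreg hj.le _ κ r) ha0
    (fun j hj x κ' μ' _ => by rw [haf']; exact norm_hol_plaqWord_avgIter_pull_sub_one_le_of_regPr F hε₀ hten7F W hreg hj.le x κ' μ') hμ0 hμ72 Yt hYt'
    (fun j hj z κ => by rw [hμf']; simp only [hYt']; exact (hpert j hj.le).2.2.1 _ z κ) Glin Nn rem Λ (fun j z κ => by rw [hremdef]) hG0 hN0 hΛ0 (fun j z κ => (hGlin j z κ).trans (add_zero _)) hNn hΛs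
    mf nf gf yf lamf (fun j => by rw [hmf]) (fun j => by rw [hnf]) (fun j => by rw [hyf]) (fun j => by rw [hgf]) (fun j => by rw [hlamf])
    (ρ := (Real.sqrt (L : ℝ))⁻¹) (θ' := θ'C) (θg := θgC) (θ₂ := θ₂C) (ΘM := ΘM) (wG := wG) (wN := wN) (wS := wS) (cA := cA) (cB0 := cB0) (cB1 := cB1C)
    hρ0 hρ1 hρm hρg hθ'0 hθg0 hθ₂0 hΘM hwG hwN hwS hcA0 hcB00 hcB10 wM hwM0
    hwMgeo
    (fun j hj => by
      have h := kappa_geo_of_windows (d := (F.P K).d) (ρ := (Real.sqrt (L : ℝ))⁻¹) (aC := 2 * (2 * ε₀C)) (k := K - n) (a := af) (α := αf)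
        (Nat.cast_nonneg _) hαf' haC j hj
      rw [hθ'C]; rw [hd, hPLr] at h ⊢; exact h)
    (fun j hj => by
      have h := K_geo_of_windows (d := (F.P K).d) (ρ := (Real.sqrt (L : ℝ))⁻¹) (aC := 2 * (2 * ε₀C)) (k := K - n) (a := af) (α := αf)
        (Nat.cast_nonneg _) hαf' haC j hj
      rw [hθgC]; rw [hd, hPLr] at h ⊢; exact h)
    (fun j hj => by
      have h := sigma_geo_of_windows (d := (F.P K).d) (L := ((F.P K).L : ℝ)) (ρ := (Real.sqrt (L : ℝ))⁻¹) (k := K - n) (μ := μf)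
        (Nat.cast_nonneg _) hμC j hj
      rw [hθ₂C]; rw [hd, hPLr] at h ⊢; exact h)
    (gauge_row_inhabited ((F.P K).L) ((F.P K).sitesPerDir (K - n)) (K - n)
      hL2F hN'pos (pull (bgUnits F K W) (basePt F n K)) (pull (fun b => expUnit (Complex.I • X b)) (basePt F n K)) hU₀p hU₁p
      (fun j hj x μ => avgIter_pull_mem_unitaryUnits_of_regPr F hε₀ hten7F W hreg hj x μ)
      (fun j hj x μ => unitaryUnits_le_U1 ((hpert j hj.le).1 x μ)) αf af μf hα0 hα24
      (fun j hj z κ r => by rw [hαf', haf']; exact norm_Wcx_avgIter_pull_sub_one_le_level_of_regPr F hε₀ hten7F W hreg hj.le _ κ r) ha0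
      (fun j hj x κ' μ' _ => by rw [haf']; exact norm_hol_plaqWord_avgIter_pull_sub_one_le_of_regPr F hε₀ hten7F W hreg hj.le x κ' μ') hμ72 Yt hYt'
      (fun j hj z κ => by rw [hμf']; simp only [hYt']; exact (hpert j hj.le).2.2.1 _ z κ) Glin Nn rem Λ
      (fun j z κ => by rw [hremdef]) hG0 hN0 hΛ0 (fun j z κ => (hGlin j z κ).trans (add_zero _)) hNn hΛs
      mf nf gf lamf (fun j => by rw [hmf]) (fun j => by rw [hnf]) (fun j => by rw [hgf]) (fun j => by rw [hlamf])
      hwG hwN wM hwM0 (L * L + L - 1) 2 (by rw [hPL]; exact hnC) (by rw [hPL]; exact hnA) hρs hdomG hdomN hdomM hdomS) hsmall hsmallS (by rw [hcB0def]; exact hcB0sq_of_choice hwG hρ0.le hρ1 (K - n))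
    (by rw [hcB1C]; exact hcB1sq_of_choice hwN (by positivity) hρ0.le hρ1) (by rw [hcAdef]; exact hcAsq_of_choice (by positivity) hρ0.le hρ1)
  -- ===== the member reading of the two slots =====
  have hS := hcell l hl.le
  have hcA' : cA = CcA * (E * mf 0) := by rw [hcAdef, hCcA, hE]
  rw [← hE, hcA'] at hS
  rw [A_letter_eq, B_letter_eq, ← hCA, ← hCB] at hS
  obtain ⟨hs1, hs2⟩ := rho_slots_T3 hL0r l
  rw [hs1, hs2] at hS
  have hN00 : (F.P K).sitesPerDir 0 = (F.P K).sitesPerDir (K - n) * (F.P K).L ^ (K - n - 0) := by rw [Nat.sub_zero]; exact hNtop.symm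
  have hm : mf 0 ^ 2 ≤ ∑ b : PBond (F.P K) 0, ‖X b‖ ^ 2 := by
    rw [hmf]; dsimp only
    rw [Real.sq_sqrt (Finset.sum_nonneg fun _ _ => Finset.sum_nonneg fun _ _ => sq_nonneg _), hG0]
    simp only [hYt', tildIter_zero']
    exact cellMass_Y0_le_of_in19_T3 F n K hN00 (basePt F n K) h19
  have hcXle : 384 * ((12 * B₁' + 1) * ee) ^ 2 + 12 * ((12 * B₁' + 1) * ee) + 60 * (2 * B₁' * ee) ^ 2 ≤ cX := by
    rw [hcX]
    have h1 : ((12 * B₁' + 1) * ee) ^ 2 ≤ ε₀C ^ 2 := pow_le_pow_left₀ hε₀.le hεle 2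
    have h2 : (2 * B₁' * ee) ^ 2 ≤ δC ^ 2 := pow_le_pow_left₀ hδ0 hδle 2
    linarith
  have hg : gf 0 ^ 2 ≤ 8 * (∑ p : Plaq (F.P K) 0, ‖((Complex.I • X ⟨p.src, p.μ⟩)
          + ((W ⟨p.src, p.μ⟩ : Matrix (Fin 2) (Fin 2) ℂ) * (Complex.I • X ⟨p.src.shift p.μ, p.ν⟩) * star (W ⟨p.src, p.μ⟩ : Matrix (Fin 2) (Fin 2) ℂ))
          - (((W ⟨p.src, p.μ⟩ * W ⟨p.src.shift p.μ, p.ν⟩ * (W ⟨p.src.shift p.ν, p.μ⟩)⁻¹ : Matrix.specialUnitaryGroup (Fin 2) ℂ) : Matrix (Fin 2) (Fin 2) ℂ)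
              * (Complex.I • X ⟨p.src.shift p.ν, p.μ⟩)
              * star ((W ⟨p.src, p.μ⟩ * W ⟨p.src.shift p.μ, p.ν⟩ * (W ⟨p.src.shift p.ν, p.μ⟩)⁻¹ : Matrix.specialUnitaryGroup (Fin 2) ℂ) : Matrix (Fin 2) (Fin 2) ℂ))
          - (((GaugeField.plaqHol W p : Matrix.specialUnitaryGroup (Fin 2) ℂ) : Matrix (Fin 2) (Fin 2) ℂ) * (Complex.I • X ⟨p.src, p.ν⟩)
              * star ((GaugeField.plaqHol W p : Matrix.specialUnitaryGroup (Fin 2) ℂ) : Matrix (Fin 2) (Fin 2) ℂ)))‖ ^ 2)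
        + 2 * ∑ x : Site (F.P K) 0, ∑ j : Fin 2, ∑ k : Fin 2,
            ‖(divB (torusT (F.P K) 0) (fun κ z => unitsField (toUField W) ⟨z, κ⟩) (fun κ z => Complex.I • X ⟨z, κ⟩) x) j k‖ ^ 2
        + cX * (((L : ℝ) ^ (K - n)) ^ 2)⁻¹ * ∑ b : PBond (F.P K) 0, ‖X b‖ ^ 2 := by
    have h2 := cellGrad_tildIter_zero_le_of_regPr_of_in19_T3 F n K hN00 (basePt F n K) hε₀.le hreg h19
    rw [hFL] at h2
    rw [hgf]; dsimp only
    rw [Real.sq_sqrt (Finset.sum_nonneg fun _ _ => Finset.sum_nonneg fun _ _ => Finset.sum_nonneg fun _ _ => sq_nonneg _), hG0]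
    simp only [hYt', B7Prop2Explicit.avgIter_zero]
    exact grad_currency_mono h2 hcXle (by positivity) (Finset.sum_nonneg fun _ _ => sq_nonneg _)
  have hr : (((Real.sqrt (L : ℝ))⁻¹) ^ (2 * (K - n))) ^ 2 = (((L : ℝ) ^ (K - n)) ^ 2)⁻¹ := by
    rw [← pow_mul, show 2 * (K - n) * 2 = 4 * (K - n) by ring, rho_pow_four_mul hL0r]
  have hcB0' : cB0 = Real.sqrt c₀ * (gf 0 + CG * ((Real.sqrt (L : ℝ))⁻¹) ^ (2 * (K - n)) * mf 0) := by
    rw [hcB0def, hc₀, hCG, hE]; ring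
  have hNl : (F.P K).sitesPerDir l = (F.P K).sitesPerDir (K - n) * (F.P K).L ^ (K - n - l) := sitesPerDir_eq_mul_pow_sub F K hl.le hKn
  show ∑ z : Site (F.P K) l, (fun x => ∑ κ : Fin (F.P K).d,
      ‖((tildIter (F.P K).L (pull (bgUnits F K W) (basePt F n K)) (pull (fun b => expUnit (Complex.I • X b)) (basePt F n K)) l x κ
        : (Matrix (Fin 2) (Fin 2) ℂ)ˣ) : Matrix (Fin 2) (Fin 2) ℂ) - 1‖ ^ 2) (tlift z) ≤ _
  have hidx := sum_site_eq_sum_boxVec (M := ℝ) hNl (fun x => ∑ κ : Fin (F.P K).d,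
      ‖((tildIter (F.P K).L (pull (bgUnits F K W) (basePt F n K)) (pull (fun b => expUnit (Complex.I • X b)) (basePt F n K)) l x κ
        : (Matrix (Fin 2) (Fin 2) ℂ)ˣ) : Matrix (Fin 2) (Fin 2) ℂ) - 1‖ ^ 2)
  refine hidx.trans_le ?_
  rw [hFL]
  exact two_slot_to_hMc_slots (Finset.sum_nonneg fun _ _ => Finset.sum_nonneg fun _ _ => Finset.sum_nonneg fun _ _ => sq_nonneg _)
    (by positivity) (by positivity) hc₀0 (by positivity) hr hcB0' hm hg hS

-- KERNEL WITNESS (no new content): G3 consumes it.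
example := fun hMc₂ hN2s => Summit.QuantumFields.YangMills.Theorems.Prop7HDOfCombRows.hD_of_hMcomb hMcomb_holds hMc₂ hN2s

end Summit.QuantumFields.YangMills.Theorems.Prop7CombHMcombHolds

end
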